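import Mathlib.NumberTheory.Padics.RingHoms
import Literature.NumberTheory.EllipticCurves.TateModule
import Literature.NumberTheory.EllipticCurves.Isogeny
import HarnessLib

/-!
# The eigen-subgroup `E[𝔮^∞]` of the `p`-primary torsion under a `K`-rational endomorphism, as a discrete
# `Γ_K`-module

Topic `NumberTheory/EllipticCurves` (complex multiplication; the CM-prime decomposition of `E[p^∞]`). For an elliptic curve `E = V`
over a field `K` with a `K`-RATIONAL endomorphism `π ∈ End_K(E)` (the tree's `WeierstrassCurve.endRing`), a prime `p` and a `p`-adic
integer `r`, the points of `E[p^∞] = V.geomPrimaryTorsion p` on which `π` «acts as `r`» — at every level: `p^k x = 0` and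
`N ≡ r (mod p^k)` imply `π x = N x` — form a subgroup `V.endEigenPrimaryTorsion p π r ≤ E[p^∞]` which is STABLE under `Γ_K`
(`π` commutes with `Γ_K`), hence a discrete `Γ_K`-module in its own right
(`WeierstrassCurve.endEigenPrimaryTorsion.instDistribMulAction`, discrete topology). For a curve with complex multiplication by
`𝓞 = ℤ[π]` defined over `K` and a prime `p = 𝔮𝔮̄` SPLIT in `𝓞`, with `r ∈ ℤ_p` the root of the minimal polynomial of `π` belonging
to `𝔮`, this is the `𝔮`-primary torsion `E[𝔮^∞] ≅ K_𝔮/𝓞_𝔮` (Rubin, LNM 1716, §2, Prop. 5.4: `E[𝔞] ≅ 𝓞/𝔞`), the coefficient module of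
the `𝔮`-adic Selmer groups of the `GL₁` Iwasawa theory of CM curves (Coates 1983 §2; Rubin 1991 §11; Agboola 2007 §3: the restricted
Selmer groups `𝔖_𝔮(K, E[𝔮^∞])`, tree `Literature.NumberTheory.EllipticCurves.Agboola2007.restrictedSelmer H M p 𝔮`, which take exactly
such a discrete `Γ_K`-module `M`).

No named fact; the definition is REAL (an explicit carrier) and its `Γ_K`-stability is proved here. The integer-approximation
phrasing avoids a `ℤ_p`-module structure on `E[p^∞]` (the same currency as the tree's ordinary-filtration statements). That the
two eigen-subgroups of the two `p`-adic roots DECOMPOSE `E[p^∞]` (`⊓ = ⊥`, `⊔ = ⊤`), are non-zero, `p`-divisible, of `ℤ_p`-corank one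
with `Γ_K` acting through a character, is proved for the crux class `j = −3375`, `p = 2`, `K ∋ √−7` in the Summits files
`Summits/BirchSwinnertonDyer/BirchSwinnertonDyer/Theorems/PrintCf2SplitBadTwoCM*.lean` (cell `bsd-print-cf2`), which this
definition serves (planner RULING (ab)(4) T4; consumer: road α of crux `PrintCf2.SplitBadTwoRankOneOfFacts`).

* `WeierstrassCurve.endEigenPrimaryTorsion V p π r` — the subgroup; `mem_endEigenPrimaryTorsion_iff`;
* `WeierstrassCurve.smul_mem_endEigenPrimaryTorsion` — `Γ_K`-stability;
* `endEigenPrimaryTorsion.instDistribMulAction`, `endEigenPrimaryTorsion.coe_smul`, the discrete topology instances.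

## References

* K. Rubin, *Elliptic curves with complex multiplication and the conjecture of Birch and Swinnerton-Dyer*, in LNM 1716 (1999),
  §2 and Prop. 5.4. [cite: Rubin1999]
* J. H. Silverman, *Advanced Topics in the Arithmetic of Elliptic Curves*, GTM 151 (1994), II §1 Prop. 1.1, II §2 Thm. 2.2(b).
* A. Agboola, *On Rubin's variant of the p-adic Birch and Swinnerton-Dyer conjecture*, Compositio Math. 143 (2007), §3.

## Design

`noncomputable section`, `open scoped Classical`, one universe `u` (the Selmer files need `M : Type u` in the universe of `K`).
Deliberate dot-notation extensions in `namespace WeierstrassCurve`. The `Γ_K`-action on the subtype is the restriction of the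
tree's action on `E[p^∞]` (`Literature.NumberTheory.EllipticCurves.primaryComponent.instDistribMulAction`); the topology is the
discrete one, as for every coefficient module of the tree's Selmer API.
-/

noncomputable section

open scoped Classical

universe u

namespace WeierstrassCurve

open Literature.NumberTheory.EllipticCurves Field

variable {K : Type u} [Field K] (V : WeierstrassCurve K) (p : ℕ) [hp : Fact p.Prime]

/-- Two integers approximating the same `p`-adic integer to order `p^k` act alike on an element killed by `p^k`. [folklore] -/
private theorem zsmul_eq_zsmul_of_approx {M : Type*} [AddCommGroup M] {k : ℕ} {x : M} (hx : p ^ k • x = 0) {r : ℤ_[p]}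
    {N N' : ℤ} (hN : ((N : ℤ_[p]) - r) ∈ (Ideal.span {(p : ℤ_[p]) ^ k} : Ideal ℤ_[p]))
    (hN' : ((N' : ℤ_[p]) - r) ∈ (Ideal.span {(p : ℤ_[p]) ^ k} : Ideal ℤ_[p])) : N • x = N' • x := by
  have h : ((N - N' : ℤ) : ℤ_[p]) ∈ (Ideal.span {(p : ℤ_[p]) ^ k} : Ideal ℤ_[p]) := by
    have := Ideal.sub_mem _ hN hN'
    push_cast
    convert this using 1
    ring
  have hdvd : (p ^ k : ℤ) ∣ N - N' := by
    rw [← PadicInt.norm_int_le_pow_iff_dvd]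
    exact (PadicInt.norm_le_pow_iff_mem_span_pow _ _).mpr h
  obtain ⟨c, hc⟩ := hdvd
  have hpk : ((p : ℤ) ^ k) • x = 0 := by
    rw [show ((p : ℤ) ^ k) = ((p ^ k : ℕ) : ℤ) by push_cast; rfl, natCast_zsmul, hx]
  have h1 : (N - N') • x = 0 := by rw [hc, mul_comm, mul_zsmul, hpk, zsmul_zero]
  rw [sub_smul] at h1
  exact sub_eq_zero.mp h1

/-- **The `r`-eigen-subgroup of `E[p^∞]` under a `K`-rational endomorphism `π`** — for a CM curve with `K`-rational complex
multiplication by `ℤ[π]` and `p = 𝔮𝔮̄` split, with `r ∈ ℤ_p` the root of the minimal polynomial of `π` at `𝔮`, this is the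
`𝔮`-primary torsion `E[𝔮^∞]`: the points `x ∈ E[p^∞]` such that, at every level, `p^k x = 0` and `N ≡ r (mod p^k)` imply
`π x = N x`. (Rubin, LNM 1716, §2: `E[𝔞]`, `E[𝔭^∞]`; Prop. 5.4: `E[𝔞] ≅ 𝓞/𝔞`.) [cite: Rubin1999, §2 and Prop. 5.4] -/
def endEigenPrimaryTorsion (π : V.endRing) (r : ℤ_[p]) : AddSubgroup (V.geomPrimaryTorsion p) where
  carrier := {x | ∀ (k : ℕ) (N : ℤ), p ^ k • x = 0 →
    ((N : ℤ_[p]) - r) ∈ (Ideal.span {(p : ℤ_[p]) ^ k} : Ideal ℤ_[p]) →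
      (π : AddMonoid.End V.geomPoints) (x : V.geomPoints) = N • (x : V.geomPoints)}
  zero_mem' := fun k N _ _ ↦ by simp
  add_mem' := by
    intro x y hx hy k N hk hN
    -- a common level killing `x`, `y` and `x + y`
    obtain ⟨kx, hkx⟩ := (AddCommGroup.mem_primaryComponent).mp x.2
    obtain ⟨ky, hky⟩ := (AddCommGroup.mem_primaryComponent).mp y.2
    have hle : ∀ {j i : ℕ}, j ≤ i → (Ideal.span {(p : ℤ_[p]) ^ i} : Ideal ℤ_[p]) ≤ Ideal.span {(p : ℤ_[p]) ^ j} :=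
      fun hji ↦ Ideal.span_singleton_le_span_singleton.mpr (pow_dvd_pow _ hji)
    obtain ⟨N', hN'⟩ : ∃ N' : ℤ, ((N' : ℤ_[p]) - r) ∈ (Ideal.span {(p : ℤ_[p]) ^ (k + kx + ky)} : Ideal ℤ_[p]) := by
      refine ⟨(PadicInt.appr r (k + kx + ky) : ℤ), ?_⟩
      have h := PadicInt.appr_spec (k + kx + ky) r
      rw [← Ideal.neg_mem_iff, neg_sub] at h
      push_cast
      exact h
    have hxk : p ^ kx • x = 0 := Subtype.ext (by rw [AddSubmonoidClass.coe_nsmul, ZeroMemClass.coe_zero]; exact hkx)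
    have hyk : p ^ ky • y = 0 := Subtype.ext (by rw [AddSubmonoidClass.coe_nsmul, ZeroMemClass.coe_zero]; exact hky)
    have hπx := hx kx N' hxk (hle (by omega) hN')
    have hπy := hy ky N' hyk (hle (by omega) hN')
    have hxy : p ^ k • ((x : V.geomPoints) + y) = 0 := by
      have := congrArg Subtype.val hk
      rwa [AddSubmonoidClass.coe_nsmul, ZeroMemClass.coe_zero, AddSubgroup.coe_add] at this
    rw [AddSubgroup.coe_add, map_add, hπx, hπy, ← smul_add]
    exact zsmul_eq_zsmul_of_approx p hxy (hle (by omega) hN') hN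
  neg_mem' := by
    intro x hx k N hk hN
    have hxk : p ^ k • x = 0 := by rw [← neg_neg x, smul_neg, hk, neg_zero]
    rw [AddSubgroup.coe_neg, map_neg, hx k N hxk hN, smul_neg]

variable {V p} in
/-- Membership in `V.endEigenPrimaryTorsion p π r` (unfolding of the definition of `E[𝔮^∞]`). [cite: Rubin1999, §2 and Prop. 5.4] -/
theorem mem_endEigenPrimaryTorsion_iff (π : V.endRing) (r : ℤ_[p]) (x : V.geomPrimaryTorsion p) :
    x ∈ V.endEigenPrimaryTorsion p π r ↔ ∀ (k : ℕ) (N : ℤ), p ^ k • x = 0 →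
      ((N : ℤ_[p]) - r) ∈ (Ideal.span {(p : ℤ_[p]) ^ k} : Ideal ℤ_[p]) →
        (π : AddMonoid.End V.geomPoints) (x : V.geomPoints) = N • (x : V.geomPoints) :=
  Iff.rfl

variable {V p} in
/-- **`Γ_K`-stability of `E[𝔮^∞]`**: a `K`-rational endomorphism commutes with `Γ_K` (definition of `End_K(E)`), so the
eigen-condition is preserved by every `σ ∈ Γ_K`. [cite: Rubin1999, §2] -/
theorem smul_mem_endEigenPrimaryTorsion (π : V.endRing) (r : ℤ_[p]) (σ : absoluteGaloisGroup K)
    {x : V.geomPrimaryTorsion p} (hx : x ∈ V.endEigenPrimaryTorsion p π r) :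
    σ • x ∈ V.endEigenPrimaryTorsion p π r := by
  intro k N hk hN
  have hequiv := (V.mem_equivariantSubring_iff (π : AddMonoid.End V.geomPoints)).1 (Subring.mem_inf.1 π.2).2
  have hxk : p ^ k • x = 0 := by
    rw [smul_comm, smul_eq_zero_iff_eq] at hk
    exact hk
  rw [primaryComponent.coe_smul, hequiv, hx k N hxk hN, smul_comm]

/-- The `Γ_K`-action on `E[𝔮^∞] = V.endEigenPrimaryTorsion p π r`, restricted from `E[p^∞]`: a discrete `Γ_K`-module
(the coefficient module `W = E[𝔭^∞]`, `W* = E[𝔭*^∞]` of Agboola 2007 §3 / Rubin 1991 §11). [cite: Rubin1999, §2] -/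
instance endEigenPrimaryTorsion.instDistribMulAction (π : V.endRing) (r : ℤ_[p]) :
    DistribMulAction (absoluteGaloisGroup K) ↥(V.endEigenPrimaryTorsion p π r) where
  smul σ x := ⟨σ • (x : V.geomPrimaryTorsion p), smul_mem_endEigenPrimaryTorsion π r σ x.2⟩
  one_smul x := Subtype.ext (one_smul _ (x : V.geomPrimaryTorsion p))
  mul_smul σ τ x := Subtype.ext (mul_smul σ τ (x : V.geomPrimaryTorsion p))
  smul_zero σ := Subtype.ext (smul_zero σ)
  smul_add σ x y := Subtype.ext (smul_add σ (x : V.geomPrimaryTorsion p) y)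

variable {V p} in
/-- Unfolding lemma for the `Γ_K`-action on `E[𝔮^∞]` (the restriction of the action on `E[p^∞]`). [cite: Rubin1999, §2] -/
@[simp]
theorem endEigenPrimaryTorsion.coe_smul (π : V.endRing) (r : ℤ_[p]) (σ : absoluteGaloisGroup K)
    (x : V.endEigenPrimaryTorsion p π r) :
    ((σ • x : V.endEigenPrimaryTorsion p π r) : V.geomPrimaryTorsion p) = σ • (x : V.geomPrimaryTorsion p) :=
  rfl

/-- `E[𝔮^∞]` carries the discrete topology (as every coefficient module of the tree's Selmer API). [folklore] -/
instance endEigenPrimaryTorsion.instTopologicalSpace (π : V.endRing) (r : ℤ_[p]) :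
    TopologicalSpace ↥(V.endEigenPrimaryTorsion p π r) := ⊥

/-- The topology on `E[𝔮^∞]` is discrete. [folklore] -/
instance endEigenPrimaryTorsion.instDiscreteTopology (π : V.endRing) (r : ℤ_[p]) :
    DiscreteTopology ↥(V.endEigenPrimaryTorsion p π r) := ⟨rfl⟩

end WeierstrassCurve

end
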